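import Summits.CriticalPhenomena.PercolationContinuityZ3.Theorems.Transplant.FKDoubleFanOneSided
import HarnessLib

/-!
# Double fans, MULTIFAN₁ middles: the piecewise certificate for `CORE4` (the all-roof endpoint polynomial of LEMMA‴), part C

Helper file (`--supports stmt-CriticalPhenomena-4575`), FK sub-lane `prim-bschramm-fk-3` (gen 34); builds on p205010 (kernel theorem, internal audit
signed; external expert review pending).  Pure real polynomial algebra, no sorries; standard axioms.  Memo `bschramm/prim-bschramm-fk-3/FAR-CROSS-IX.md` §6–§6i.

Context.  `…DoubleFanMultifan` reduces cross-apex negative correlation across every two-sided middle whose `a`-spokes precede its `b`-spokes (every distance,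
every weighted double fan `K₂ ∨ P_n`, `0 < q ≤ 1`) to the four-leg inequality LEMMA‴; its endpoint table (memo §6) consists of tensor-Bernstein cells, zero cells,
closed forms, the two CORE-sized polynomials `𝒞₁, 𝒞₂` (`…MultifanC1Cert*/C2Cert*`) and the all-roof cell `q²(1−q)(2−q)·CORE4`, `CORE4` a polynomial of 1,863 terms in
`q, t_f, w_f, t_g, w_g, t_u, w_u, t_s, w_s` (degree 7 in `q`, ≤ 2 in every other variable).  `CORE4 ≥ 0` on `t ≥ 0`, `q, w ∈ [0,1]` by a PIECEWISE polynomial certificate: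
  `CORE4 = (2−q)·V² + q(2−q)³·[t_s(w_s w_u T − U)² + t_u(w_s w_u T − S)² + T(U+S)²] + Σ_e t_f^{e₁} t_g^{e₂} t_u^{e₃} t_s^{e₄} · R_e(q, w)`,
  `T = t_f + t_g + q t_f t_g`, `U = w_f(w_g − w_s) t_u`, `S = w_g(w_f − w_u) t_s`, `V = (2−q)(w_s w_u T − U − S) + 2(1−q)·m`,
with `m = m_P := w_u w_s(1−w_f) − w_f(w_g−w_s)(1−w_u)` on the region `P = {w_g ≥ w_s}`, `m = m_M := −w_f w_g(1−w_s)(1−w_u)` on `M = {w_s ≥ w_g, w_u ≥ w_f}`, and the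
mirror image `(t_f,w_f,t_u,w_u) ↔ (t_g,w_g,t_s,w_s)` of the P-certificate on `{w_f ≥ w_u}` (CORE4 is mirror-symmetric).  There are 37 non-zero cells `R_e` per region; the
31 cells not involving `m` are common to both regions.  Every cell is `≥ 0` on its region by an explicit certificate — a tensor-Bernstein expansion with non-negative
coefficients, or positive multiples of SQUARE PATTERNS (`(w−w′)²`, `(1−w−w′)²`, `(αw−βw′)²`, `(αw(1−w′)−βw″)²`, `(ww′−w″w‴)²`) times Bernstein elements plus such an
expansion — where the region cells are certified after the box substitutions `w_s = w_g·σ` (P) and `w_f = w_u·φ, w_g = w_s·γ` (M), which map `[0,1]²` onto the region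
(found by linear programming; exact rational vertices; every identity below is checked by `ring`, every sign by `positivity`).  This file: `core4R0112`, `core4R0121`, `core4R1012`, `core4R1021`, `core4R1112`, `core4R1121`.
[folklore]
-/

noncomputable section

namespace Summit.CriticalPhenomena.PercolationContinuityZ3.Theorems

namespace FK

namespace ThreeApex

/-- CORE4 certificate, common remainder cell: coefficient of `t_f^0 t_g^1 t_u^1 t_s^2` in `CORE4 − (2−q)V² − q(2−q)³·cubic` (polynomial in `q, w_f, w_g, w_u, w_s`). [folklore] -/
def core4R0112 (q wf wg wu _ws : ℝ) : ℝ :=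
  (2 : ℝ) * q ^ 5 * wf ^ 2 * wg ^ 2 * wu ^ 2 + ((-8) : ℝ) * q ^ 4 * wf ^ 2 * wg ^ 2 * wu ^ 2 + ((-2) : ℝ) * q ^ 5 * wf * wg ^ 2 * wu ^ 2 + ((-2) : ℝ) * q ^ 5 * wf ^ 2 * wg ^ 2 * wu +
    (8 : ℝ) * q ^ 3 * wf ^ 2 * wg ^ 2 * wu ^ 2 + (8 : ℝ) * q ^ 4 * wf * wg ^ 2 * wu ^ 2 + (8 : ℝ) * q ^ 4 * wf ^ 2 * wg ^ 2 * wu + (4 : ℝ) * q ^ 5 * wf * wg ^ 2 * wu +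
    ((-1) : ℝ) * q ^ 5 * wf ^ 2 * wg ^ 2 + ((-1) : ℝ) * q ^ 5 * wg ^ 2 * wu ^ 2 + ((-8) : ℝ) * q ^ 3 * wf * wg ^ 2 * wu ^ 2 + ((-8) : ℝ) * q ^ 3 * wf ^ 2 * wg ^ 2 * wu +
    ((-20) : ℝ) * q ^ 4 * wf * wg ^ 2 * wu + (6 : ℝ) * q ^ 4 * wf ^ 2 * wg ^ 2 + (6 : ℝ) * q ^ 4 * wg ^ 2 * wu ^ 2 + (32 : ℝ) * q ^ 3 * wf * wg ^ 2 * wu +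
    ((-12) : ℝ) * q ^ 3 * wf ^ 2 * wg ^ 2 + ((-12) : ℝ) * q ^ 3 * wg ^ 2 * wu ^ 2 + ((-16) : ℝ) * q ^ 2 * wf * wg ^ 2 * wu + (8 : ℝ) * q ^ 2 * wf ^ 2 * wg ^ 2 +
    (8 : ℝ) * q ^ 2 * wg ^ 2 * wu ^ 2

set_option maxRecDepth 30000 in
set_option maxHeartbeats 2000000 in
/-- `core4R0112 ≥ 0` on the box `q, w ∈ [0,1]`: 6 positive multiples of square patterns times Bernstein elements plus a tensor-Bernstein expansion with non-negative coefficients (nested Horner-by-variable form; found by LP, exact rational vertex). [folklore] -/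
theorem core4R0112_nonneg {q wf wg wu ws : ℝ} (hq0 : 0 ≤ q) (hq1 : q ≤ 1) (_hwf0 : 0 ≤ wf) (_hwf1 : wf ≤ 1) (_hwg0 : 0 ≤ wg) (_hwg1 : wg ≤ 1) (_hwu0 : 0 ≤ wu) (_hwu1 : wu ≤ 1) (hws0 : 0 ≤ ws) (hws1 : ws ≤ 1) :
    0 ≤ core4R0112 q wf wg wu ws := by
  have hq1' : (0:ℝ) ≤ 1 - q := sub_nonneg.2 hq1
  have hws1' : (0:ℝ) ≤ 1 - ws := sub_nonneg.2 hws1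
  have e : core4R0112 q wf wg wu ws =
      (8 : ℝ) * (wf - wu) ^ 2 * q ^ 2 * (1 - q) ^ 3 * wg ^ 2 * (1 - ws) + (8 : ℝ) * (wf - wu) ^ 2 * q ^ 2 * (1 - q) ^ 3 * wg ^ 2 * ws +
      (8 : ℝ) * (wf - wu) ^ 2 * q ^ 3 * (1 - q) ^ 2 * wg ^ 2 * (1 - ws) + (8 : ℝ) * (wf - wu) ^ 2 * q ^ 3 * (1 - q) ^ 2 * wg ^ 2 * ws +
      (2 : ℝ) * (wf - wu) ^ 2 * q ^ 4 * (1 - q) * wg ^ 2 * (1 - ws) + (2 : ℝ) * (wf - wu) ^ 2 * q ^ 4 * (1 - q) * wg ^ 2 * ws +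
      q ^ 3 * (1 - q) ^ 2 * ((1 - wf) ^ 2 * (wg ^ 2 * (wu ^ 2 * ((4 : ℝ) * (1 - ws) + (4 : ℝ) * ws))) + wf ^ 2 * (wg ^ 2 * ((1 - wu) ^ 2 * ((4 : ℝ) * (1 - ws) + (4 : ℝ) * ws)))) +
      q ^ 4 * (1 - q) * ((1 - wf) ^ 2 * (wg ^ 2 * (wu ^ 2 * ((4 : ℝ) * (1 - ws) + (4 : ℝ) * ws))) + wf ^ 2 * (wg ^ 2 * ((1 - wu) ^ 2 * ((4 : ℝ) * (1 - ws) + (4 : ℝ) * ws)))) +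
      q ^ 5 * ((1 - wf) ^ 2 * (wg ^ 2 * (wu ^ 2 * ((1 : ℝ) * (1 - ws) + (1 : ℝ) * ws))) + wf ^ 2 * (wg ^ 2 * ((1 - wu) ^ 2 * ((1 : ℝ) * (1 - ws) + (1 : ℝ) * ws)))) := by
    simp only [core4R0112]; ring
  rw [e]; positivity

/-- CORE4 certificate, common remainder cell: coefficient of `t_f^0 t_g^1 t_u^2 t_s^1` in `CORE4 − (2−q)V² − q(2−q)³·cubic` (polynomial in `q, w_f, w_g, w_u, w_s`). [folklore] -/
def core4R0121 (q wf wg _wu ws : ℝ) : ℝ :=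
  (2 : ℝ) * q ^ 5 * wf ^ 2 * wg ^ 2 * ws ^ 2 + ((-8) : ℝ) * q ^ 4 * wf ^ 2 * wg ^ 2 * ws ^ 2 + ((-2) : ℝ) * q ^ 5 * wf ^ 2 * wg * ws ^ 2 + ((-2) : ℝ) * q ^ 5 * wf ^ 2 * wg ^ 2 * ws +
    (8 : ℝ) * q ^ 3 * wf ^ 2 * wg ^ 2 * ws ^ 2 + (8 : ℝ) * q ^ 4 * wf ^ 2 * wg * ws ^ 2 + (8 : ℝ) * q ^ 4 * wf ^ 2 * wg ^ 2 * ws + (4 : ℝ) * q ^ 5 * wf ^ 2 * wg * ws +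
    ((-1) : ℝ) * q ^ 5 * wf ^ 2 * wg ^ 2 + ((-1) : ℝ) * q ^ 5 * wf ^ 2 * ws ^ 2 + ((-8) : ℝ) * q ^ 3 * wf ^ 2 * wg * ws ^ 2 + ((-8) : ℝ) * q ^ 3 * wf ^ 2 * wg ^ 2 * ws +
    ((-20) : ℝ) * q ^ 4 * wf ^ 2 * wg * ws + (6 : ℝ) * q ^ 4 * wf ^ 2 * wg ^ 2 + (6 : ℝ) * q ^ 4 * wf ^ 2 * ws ^ 2 + (32 : ℝ) * q ^ 3 * wf ^ 2 * wg * ws +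
    ((-12) : ℝ) * q ^ 3 * wf ^ 2 * wg ^ 2 + ((-12) : ℝ) * q ^ 3 * wf ^ 2 * ws ^ 2 + ((-16) : ℝ) * q ^ 2 * wf ^ 2 * wg * ws + (8 : ℝ) * q ^ 2 * wf ^ 2 * wg ^ 2 +
    (8 : ℝ) * q ^ 2 * wf ^ 2 * ws ^ 2

set_option maxRecDepth 30000 in
set_option maxHeartbeats 2000000 in
/-- `core4R0121 ≥ 0` on the box `q, w ∈ [0,1]`: 6 positive multiples of square patterns times Bernstein elements plus a tensor-Bernstein expansion with non-negative coefficients (nested Horner-by-variable form; found by LP, exact rational vertex). [folklore] -/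
theorem core4R0121_nonneg {q wf wg wu ws : ℝ} (hq0 : 0 ≤ q) (hq1 : q ≤ 1) (_hwf0 : 0 ≤ wf) (_hwf1 : wf ≤ 1) (_hwg0 : 0 ≤ wg) (_hwg1 : wg ≤ 1) (hwu0 : 0 ≤ wu) (hwu1 : wu ≤ 1) (_hws0 : 0 ≤ ws) (_hws1 : ws ≤ 1) :
    0 ≤ core4R0121 q wf wg wu ws := by
  have hq1' : (0:ℝ) ≤ 1 - q := sub_nonneg.2 hq1
  have hwu1' : (0:ℝ) ≤ 1 - wu := sub_nonneg.2 hwu1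
  have e : core4R0121 q wf wg wu ws =
      (8 : ℝ) * (wg - ws) ^ 2 * q ^ 2 * (1 - q) ^ 3 * wf ^ 2 * (1 - wu) + (8 : ℝ) * (wg - ws) ^ 2 * q ^ 2 * (1 - q) ^ 3 * wf ^ 2 * wu +
      (8 : ℝ) * (wg - ws) ^ 2 * q ^ 3 * (1 - q) ^ 2 * wf ^ 2 * (1 - wu) + (8 : ℝ) * (wg - ws) ^ 2 * q ^ 3 * (1 - q) ^ 2 * wf ^ 2 * wu +
      (2 : ℝ) * (wg - ws) ^ 2 * q ^ 4 * (1 - q) * wf ^ 2 * (1 - wu) + (2 : ℝ) * (wg - ws) ^ 2 * q ^ 4 * (1 - q) * wf ^ 2 * wu +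
      q ^ 3 * (1 - q) ^ 2 * (wf ^ 2 * ((1 - wg) ^ 2 * ((1 - wu) * ((4 : ℝ) * ws ^ 2) + wu * ((4 : ℝ) * ws ^ 2)) + wg ^ 2 * ((1 - wu) * ((4 : ℝ) * (1 - ws) ^ 2) +
      wu * ((4 : ℝ) * (1 - ws) ^ 2)))) + q ^ 4 * (1 - q) * (wf ^ 2 * ((1 - wg) ^ 2 * ((1 - wu) * ((4 : ℝ) * ws ^ 2) + wu * ((4 : ℝ) * ws ^ 2)) +
      wg ^ 2 * ((1 - wu) * ((4 : ℝ) * (1 - ws) ^ 2) + wu * ((4 : ℝ) * (1 - ws) ^ 2)))) + q ^ 5 * (wf ^ 2 * ((1 - wg) ^ 2 * ((1 - wu) * ((1 : ℝ) * ws ^ 2) +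
      wu * ((1 : ℝ) * ws ^ 2)) + wg ^ 2 * ((1 - wu) * ((1 : ℝ) * (1 - ws) ^ 2) + wu * ((1 : ℝ) * (1 - ws) ^ 2)))) := by
    simp only [core4R0121]; ring
  rw [e]; positivity

/-- CORE4 certificate, common remainder cell: coefficient of `t_f^1 t_g^0 t_u^1 t_s^2` in `CORE4 − (2−q)V² − q(2−q)³·cubic` (polynomial in `q, w_f, w_g, w_u, w_s`). [folklore] -/
def core4R1012 (q wf wg wu _ws : ℝ) : ℝ :=
  (2 : ℝ) * q ^ 5 * wf ^ 2 * wg ^ 2 * wu ^ 2 + ((-8) : ℝ) * q ^ 4 * wf ^ 2 * wg ^ 2 * wu ^ 2 + ((-2) : ℝ) * q ^ 5 * wf * wg ^ 2 * wu ^ 2 + ((-2) : ℝ) * q ^ 5 * wf ^ 2 * wg ^ 2 * wu +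
    (8 : ℝ) * q ^ 3 * wf ^ 2 * wg ^ 2 * wu ^ 2 + (8 : ℝ) * q ^ 4 * wf * wg ^ 2 * wu ^ 2 + (8 : ℝ) * q ^ 4 * wf ^ 2 * wg ^ 2 * wu + (4 : ℝ) * q ^ 5 * wf * wg ^ 2 * wu +
    ((-1) : ℝ) * q ^ 5 * wf ^ 2 * wg ^ 2 + ((-1) : ℝ) * q ^ 5 * wg ^ 2 * wu ^ 2 + ((-8) : ℝ) * q ^ 3 * wf * wg ^ 2 * wu ^ 2 + ((-8) : ℝ) * q ^ 3 * wf ^ 2 * wg ^ 2 * wu +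
    ((-20) : ℝ) * q ^ 4 * wf * wg ^ 2 * wu + (6 : ℝ) * q ^ 4 * wf ^ 2 * wg ^ 2 + (6 : ℝ) * q ^ 4 * wg ^ 2 * wu ^ 2 + (32 : ℝ) * q ^ 3 * wf * wg ^ 2 * wu +
    ((-12) : ℝ) * q ^ 3 * wf ^ 2 * wg ^ 2 + ((-12) : ℝ) * q ^ 3 * wg ^ 2 * wu ^ 2 + ((-16) : ℝ) * q ^ 2 * wf * wg ^ 2 * wu + (8 : ℝ) * q ^ 2 * wf ^ 2 * wg ^ 2 +
    (8 : ℝ) * q ^ 2 * wg ^ 2 * wu ^ 2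

set_option maxRecDepth 30000 in
set_option maxHeartbeats 2000000 in
/-- `core4R1012 ≥ 0` on the box `q, w ∈ [0,1]`: 6 positive multiples of square patterns times Bernstein elements plus a tensor-Bernstein expansion with non-negative coefficients (nested Horner-by-variable form; found by LP, exact rational vertex). [folklore] -/
theorem core4R1012_nonneg {q wf wg wu ws : ℝ} (hq0 : 0 ≤ q) (hq1 : q ≤ 1) (_hwf0 : 0 ≤ wf) (_hwf1 : wf ≤ 1) (_hwg0 : 0 ≤ wg) (_hwg1 : wg ≤ 1) (_hwu0 : 0 ≤ wu) (_hwu1 : wu ≤ 1) (hws0 : 0 ≤ ws) (hws1 : ws ≤ 1) :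
    0 ≤ core4R1012 q wf wg wu ws := by
  have hq1' : (0:ℝ) ≤ 1 - q := sub_nonneg.2 hq1
  have hws1' : (0:ℝ) ≤ 1 - ws := sub_nonneg.2 hws1
  have e : core4R1012 q wf wg wu ws =
      (8 : ℝ) * (wf - wu) ^ 2 * q ^ 2 * (1 - q) ^ 3 * wg ^ 2 * (1 - ws) + (8 : ℝ) * (wf - wu) ^ 2 * q ^ 2 * (1 - q) ^ 3 * wg ^ 2 * ws +
      (8 : ℝ) * (wf - wu) ^ 2 * q ^ 3 * (1 - q) ^ 2 * wg ^ 2 * (1 - ws) + (8 : ℝ) * (wf - wu) ^ 2 * q ^ 3 * (1 - q) ^ 2 * wg ^ 2 * ws +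
      (2 : ℝ) * (wf - wu) ^ 2 * q ^ 4 * (1 - q) * wg ^ 2 * (1 - ws) + (2 : ℝ) * (wf - wu) ^ 2 * q ^ 4 * (1 - q) * wg ^ 2 * ws +
      q ^ 3 * (1 - q) ^ 2 * ((1 - wf) ^ 2 * (wg ^ 2 * (wu ^ 2 * ((4 : ℝ) * (1 - ws) + (4 : ℝ) * ws))) + wf ^ 2 * (wg ^ 2 * ((1 - wu) ^ 2 * ((4 : ℝ) * (1 - ws) + (4 : ℝ) * ws)))) +
      q ^ 4 * (1 - q) * ((1 - wf) ^ 2 * (wg ^ 2 * (wu ^ 2 * ((4 : ℝ) * (1 - ws) + (4 : ℝ) * ws))) + wf ^ 2 * (wg ^ 2 * ((1 - wu) ^ 2 * ((4 : ℝ) * (1 - ws) + (4 : ℝ) * ws)))) +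
      q ^ 5 * ((1 - wf) ^ 2 * (wg ^ 2 * (wu ^ 2 * ((1 : ℝ) * (1 - ws) + (1 : ℝ) * ws))) + wf ^ 2 * (wg ^ 2 * ((1 - wu) ^ 2 * ((1 : ℝ) * (1 - ws) + (1 : ℝ) * ws)))) := by
    simp only [core4R1012]; ring
  rw [e]; positivity

/-- CORE4 certificate, common remainder cell: coefficient of `t_f^1 t_g^0 t_u^2 t_s^1` in `CORE4 − (2−q)V² − q(2−q)³·cubic` (polynomial in `q, w_f, w_g, w_u, w_s`). [folklore] -/
def core4R1021 (q wf wg _wu ws : ℝ) : ℝ :=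
  (2 : ℝ) * q ^ 5 * wf ^ 2 * wg ^ 2 * ws ^ 2 + ((-8) : ℝ) * q ^ 4 * wf ^ 2 * wg ^ 2 * ws ^ 2 + ((-2) : ℝ) * q ^ 5 * wf ^ 2 * wg * ws ^ 2 + ((-2) : ℝ) * q ^ 5 * wf ^ 2 * wg ^ 2 * ws +
    (8 : ℝ) * q ^ 3 * wf ^ 2 * wg ^ 2 * ws ^ 2 + (8 : ℝ) * q ^ 4 * wf ^ 2 * wg * ws ^ 2 + (8 : ℝ) * q ^ 4 * wf ^ 2 * wg ^ 2 * ws + (4 : ℝ) * q ^ 5 * wf ^ 2 * wg * ws +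
    ((-1) : ℝ) * q ^ 5 * wf ^ 2 * wg ^ 2 + ((-1) : ℝ) * q ^ 5 * wf ^ 2 * ws ^ 2 + ((-8) : ℝ) * q ^ 3 * wf ^ 2 * wg * ws ^ 2 + ((-8) : ℝ) * q ^ 3 * wf ^ 2 * wg ^ 2 * ws +
    ((-20) : ℝ) * q ^ 4 * wf ^ 2 * wg * ws + (6 : ℝ) * q ^ 4 * wf ^ 2 * wg ^ 2 + (6 : ℝ) * q ^ 4 * wf ^ 2 * ws ^ 2 + (32 : ℝ) * q ^ 3 * wf ^ 2 * wg * ws +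
    ((-12) : ℝ) * q ^ 3 * wf ^ 2 * wg ^ 2 + ((-12) : ℝ) * q ^ 3 * wf ^ 2 * ws ^ 2 + ((-16) : ℝ) * q ^ 2 * wf ^ 2 * wg * ws + (8 : ℝ) * q ^ 2 * wf ^ 2 * wg ^ 2 +
    (8 : ℝ) * q ^ 2 * wf ^ 2 * ws ^ 2

set_option maxRecDepth 30000 in
set_option maxHeartbeats 2000000 in
/-- `core4R1021 ≥ 0` on the box `q, w ∈ [0,1]`: 6 positive multiples of square patterns times Bernstein elements plus a tensor-Bernstein expansion with non-negative coefficients (nested Horner-by-variable form; found by LP, exact rational vertex). [folklore] -/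
theorem core4R1021_nonneg {q wf wg wu ws : ℝ} (hq0 : 0 ≤ q) (hq1 : q ≤ 1) (_hwf0 : 0 ≤ wf) (_hwf1 : wf ≤ 1) (_hwg0 : 0 ≤ wg) (_hwg1 : wg ≤ 1) (hwu0 : 0 ≤ wu) (hwu1 : wu ≤ 1) (_hws0 : 0 ≤ ws) (_hws1 : ws ≤ 1) :
    0 ≤ core4R1021 q wf wg wu ws := by
  have hq1' : (0:ℝ) ≤ 1 - q := sub_nonneg.2 hq1
  have hwu1' : (0:ℝ) ≤ 1 - wu := sub_nonneg.2 hwu1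
  have e : core4R1021 q wf wg wu ws =
      (8 : ℝ) * (wg - ws) ^ 2 * q ^ 2 * (1 - q) ^ 3 * wf ^ 2 * (1 - wu) + (8 : ℝ) * (wg - ws) ^ 2 * q ^ 2 * (1 - q) ^ 3 * wf ^ 2 * wu +
      (8 : ℝ) * (wg - ws) ^ 2 * q ^ 3 * (1 - q) ^ 2 * wf ^ 2 * (1 - wu) + (8 : ℝ) * (wg - ws) ^ 2 * q ^ 3 * (1 - q) ^ 2 * wf ^ 2 * wu +
      (2 : ℝ) * (wg - ws) ^ 2 * q ^ 4 * (1 - q) * wf ^ 2 * (1 - wu) + (2 : ℝ) * (wg - ws) ^ 2 * q ^ 4 * (1 - q) * wf ^ 2 * wu +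
      q ^ 3 * (1 - q) ^ 2 * (wf ^ 2 * ((1 - wg) ^ 2 * ((1 - wu) * ((4 : ℝ) * ws ^ 2) + wu * ((4 : ℝ) * ws ^ 2)) + wg ^ 2 * ((1 - wu) * ((4 : ℝ) * (1 - ws) ^ 2) +
      wu * ((4 : ℝ) * (1 - ws) ^ 2)))) + q ^ 4 * (1 - q) * (wf ^ 2 * ((1 - wg) ^ 2 * ((1 - wu) * ((4 : ℝ) * ws ^ 2) + wu * ((4 : ℝ) * ws ^ 2)) +
      wg ^ 2 * ((1 - wu) * ((4 : ℝ) * (1 - ws) ^ 2) + wu * ((4 : ℝ) * (1 - ws) ^ 2)))) + q ^ 5 * (wf ^ 2 * ((1 - wg) ^ 2 * ((1 - wu) * ((1 : ℝ) * ws ^ 2) +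
      wu * ((1 : ℝ) * ws ^ 2)) + wg ^ 2 * ((1 - wu) * ((1 : ℝ) * (1 - ws) ^ 2) + wu * ((1 : ℝ) * (1 - ws) ^ 2)))) := by
    simp only [core4R1021]; ring
  rw [e]; positivity

/-- CORE4 certificate, common remainder cell: coefficient of `t_f^1 t_g^1 t_u^1 t_s^2` in `CORE4 − (2−q)V² − q(2−q)³·cubic` (polynomial in `q, w_f, w_g, w_u, w_s`). [folklore] -/
def core4R1112 (q wf wg wu _ws : ℝ) : ℝ :=
  (2 : ℝ) * q ^ 6 * wf ^ 2 * wg ^ 2 * wu ^ 2 + ((-8) : ℝ) * q ^ 5 * wf ^ 2 * wg ^ 2 * wu ^ 2 + ((-2) : ℝ) * q ^ 6 * wf * wg ^ 2 * wu ^ 2 + ((-2) : ℝ) * q ^ 6 * wf ^ 2 * wg ^ 2 * wu +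
    (8 : ℝ) * q ^ 4 * wf ^ 2 * wg ^ 2 * wu ^ 2 + (8 : ℝ) * q ^ 5 * wf * wg ^ 2 * wu ^ 2 + (8 : ℝ) * q ^ 5 * wf ^ 2 * wg ^ 2 * wu + (4 : ℝ) * q ^ 6 * wf * wg ^ 2 * wu +
    ((-1) : ℝ) * q ^ 6 * wf ^ 2 * wg ^ 2 + ((-1) : ℝ) * q ^ 6 * wg ^ 2 * wu ^ 2 + ((-8) : ℝ) * q ^ 4 * wf * wg ^ 2 * wu ^ 2 + ((-8) : ℝ) * q ^ 4 * wf ^ 2 * wg ^ 2 * wu +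
    ((-20) : ℝ) * q ^ 5 * wf * wg ^ 2 * wu + (6 : ℝ) * q ^ 5 * wf ^ 2 * wg ^ 2 + (6 : ℝ) * q ^ 5 * wg ^ 2 * wu ^ 2 + (32 : ℝ) * q ^ 4 * wf * wg ^ 2 * wu +
    ((-12) : ℝ) * q ^ 4 * wf ^ 2 * wg ^ 2 + ((-12) : ℝ) * q ^ 4 * wg ^ 2 * wu ^ 2 + ((-16) : ℝ) * q ^ 3 * wf * wg ^ 2 * wu + (8 : ℝ) * q ^ 3 * wf ^ 2 * wg ^ 2 +
    (8 : ℝ) * q ^ 3 * wg ^ 2 * wu ^ 2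

set_option maxRecDepth 30000 in
set_option maxHeartbeats 2000000 in
/-- `core4R1112 ≥ 0` on the box `q, w ∈ [0,1]`: 6 positive multiples of square patterns times Bernstein elements plus a tensor-Bernstein expansion with non-negative coefficients (nested Horner-by-variable form; found by LP, exact rational vertex). [folklore] -/
theorem core4R1112_nonneg {q wf wg wu ws : ℝ} (hq0 : 0 ≤ q) (hq1 : q ≤ 1) (_hwf0 : 0 ≤ wf) (_hwf1 : wf ≤ 1) (_hwg0 : 0 ≤ wg) (_hwg1 : wg ≤ 1) (_hwu0 : 0 ≤ wu) (_hwu1 : wu ≤ 1) (hws0 : 0 ≤ ws) (hws1 : ws ≤ 1) :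
    0 ≤ core4R1112 q wf wg wu ws := by
  have hq1' : (0:ℝ) ≤ 1 - q := sub_nonneg.2 hq1
  have hws1' : (0:ℝ) ≤ 1 - ws := sub_nonneg.2 hws1
  have e : core4R1112 q wf wg wu ws =
      (8 : ℝ) * (wf - wu) ^ 2 * q ^ 3 * (1 - q) ^ 3 * wg ^ 2 * (1 - ws) + (8 : ℝ) * (wf - wu) ^ 2 * q ^ 3 * (1 - q) ^ 3 * wg ^ 2 * ws +
      (8 : ℝ) * (wf - wu) ^ 2 * q ^ 4 * (1 - q) ^ 2 * wg ^ 2 * (1 - ws) + (8 : ℝ) * (wf - wu) ^ 2 * q ^ 4 * (1 - q) ^ 2 * wg ^ 2 * ws +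
      (2 : ℝ) * (wf - wu) ^ 2 * q ^ 5 * (1 - q) * wg ^ 2 * (1 - ws) + (2 : ℝ) * (wf - wu) ^ 2 * q ^ 5 * (1 - q) * wg ^ 2 * ws +
      q ^ 4 * (1 - q) ^ 2 * ((1 - wf) ^ 2 * (wg ^ 2 * (wu ^ 2 * ((4 : ℝ) * (1 - ws) + (4 : ℝ) * ws))) + wf ^ 2 * (wg ^ 2 * ((1 - wu) ^ 2 * ((4 : ℝ) * (1 - ws) + (4 : ℝ) * ws)))) +
      q ^ 5 * (1 - q) * ((1 - wf) ^ 2 * (wg ^ 2 * (wu ^ 2 * ((4 : ℝ) * (1 - ws) + (4 : ℝ) * ws))) + wf ^ 2 * (wg ^ 2 * ((1 - wu) ^ 2 * ((4 : ℝ) * (1 - ws) + (4 : ℝ) * ws)))) +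
      q ^ 6 * ((1 - wf) ^ 2 * (wg ^ 2 * (wu ^ 2 * ((1 : ℝ) * (1 - ws) + (1 : ℝ) * ws))) + wf ^ 2 * (wg ^ 2 * ((1 - wu) ^ 2 * ((1 : ℝ) * (1 - ws) + (1 : ℝ) * ws)))) := by
    simp only [core4R1112]; ring
  rw [e]; positivity

/-- CORE4 certificate, common remainder cell: coefficient of `t_f^1 t_g^1 t_u^2 t_s^1` in `CORE4 − (2−q)V² − q(2−q)³·cubic` (polynomial in `q, w_f, w_g, w_u, w_s`). [folklore] -/
def core4R1121 (q wf wg _wu ws : ℝ) : ℝ :=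
  (2 : ℝ) * q ^ 6 * wf ^ 2 * wg ^ 2 * ws ^ 2 + ((-8) : ℝ) * q ^ 5 * wf ^ 2 * wg ^ 2 * ws ^ 2 + ((-2) : ℝ) * q ^ 6 * wf ^ 2 * wg * ws ^ 2 + ((-2) : ℝ) * q ^ 6 * wf ^ 2 * wg ^ 2 * ws +
    (8 : ℝ) * q ^ 4 * wf ^ 2 * wg ^ 2 * ws ^ 2 + (8 : ℝ) * q ^ 5 * wf ^ 2 * wg * ws ^ 2 + (8 : ℝ) * q ^ 5 * wf ^ 2 * wg ^ 2 * ws + (4 : ℝ) * q ^ 6 * wf ^ 2 * wg * ws +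
    ((-1) : ℝ) * q ^ 6 * wf ^ 2 * wg ^ 2 + ((-1) : ℝ) * q ^ 6 * wf ^ 2 * ws ^ 2 + ((-8) : ℝ) * q ^ 4 * wf ^ 2 * wg * ws ^ 2 + ((-8) : ℝ) * q ^ 4 * wf ^ 2 * wg ^ 2 * ws +
    ((-20) : ℝ) * q ^ 5 * wf ^ 2 * wg * ws + (6 : ℝ) * q ^ 5 * wf ^ 2 * wg ^ 2 + (6 : ℝ) * q ^ 5 * wf ^ 2 * ws ^ 2 + (32 : ℝ) * q ^ 4 * wf ^ 2 * wg * ws +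
    ((-12) : ℝ) * q ^ 4 * wf ^ 2 * wg ^ 2 + ((-12) : ℝ) * q ^ 4 * wf ^ 2 * ws ^ 2 + ((-16) : ℝ) * q ^ 3 * wf ^ 2 * wg * ws + (8 : ℝ) * q ^ 3 * wf ^ 2 * wg ^ 2 +
    (8 : ℝ) * q ^ 3 * wf ^ 2 * ws ^ 2

set_option maxRecDepth 30000 in
set_option maxHeartbeats 2000000 in
/-- `core4R1121 ≥ 0` on the box `q, w ∈ [0,1]`: 6 positive multiples of square patterns times Bernstein elements plus a tensor-Bernstein expansion with non-negative coefficients (nested Horner-by-variable form; found by LP, exact rational vertex). [folklore] -/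
theorem core4R1121_nonneg {q wf wg wu ws : ℝ} (hq0 : 0 ≤ q) (hq1 : q ≤ 1) (_hwf0 : 0 ≤ wf) (_hwf1 : wf ≤ 1) (_hwg0 : 0 ≤ wg) (_hwg1 : wg ≤ 1) (hwu0 : 0 ≤ wu) (hwu1 : wu ≤ 1) (_hws0 : 0 ≤ ws) (_hws1 : ws ≤ 1) :
    0 ≤ core4R1121 q wf wg wu ws := by
  have hq1' : (0:ℝ) ≤ 1 - q := sub_nonneg.2 hq1
  have hwu1' : (0:ℝ) ≤ 1 - wu := sub_nonneg.2 hwu1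
  have e : core4R1121 q wf wg wu ws =
      (8 : ℝ) * (wg - ws) ^ 2 * q ^ 3 * (1 - q) ^ 3 * wf ^ 2 * (1 - wu) + (8 : ℝ) * (wg - ws) ^ 2 * q ^ 3 * (1 - q) ^ 3 * wf ^ 2 * wu +
      (8 : ℝ) * (wg - ws) ^ 2 * q ^ 4 * (1 - q) ^ 2 * wf ^ 2 * (1 - wu) + (8 : ℝ) * (wg - ws) ^ 2 * q ^ 4 * (1 - q) ^ 2 * wf ^ 2 * wu +
      (2 : ℝ) * (wg - ws) ^ 2 * q ^ 5 * (1 - q) * wf ^ 2 * (1 - wu) + (2 : ℝ) * (wg - ws) ^ 2 * q ^ 5 * (1 - q) * wf ^ 2 * wu +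
      q ^ 4 * (1 - q) ^ 2 * (wf ^ 2 * ((1 - wg) ^ 2 * ((1 - wu) * ((4 : ℝ) * ws ^ 2) + wu * ((4 : ℝ) * ws ^ 2)) + wg ^ 2 * ((1 - wu) * ((4 : ℝ) * (1 - ws) ^ 2) +
      wu * ((4 : ℝ) * (1 - ws) ^ 2)))) + q ^ 5 * (1 - q) * (wf ^ 2 * ((1 - wg) ^ 2 * ((1 - wu) * ((4 : ℝ) * ws ^ 2) + wu * ((4 : ℝ) * ws ^ 2)) +
      wg ^ 2 * ((1 - wu) * ((4 : ℝ) * (1 - ws) ^ 2) + wu * ((4 : ℝ) * (1 - ws) ^ 2)))) + q ^ 6 * (wf ^ 2 * ((1 - wg) ^ 2 * ((1 - wu) * ((1 : ℝ) * ws ^ 2) +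
      wu * ((1 : ℝ) * ws ^ 2)) + wg ^ 2 * ((1 - wu) * ((1 : ℝ) * (1 - ws) ^ 2) + wu * ((1 : ℝ) * (1 - ws) ^ 2)))) := by
    simp only [core4R1121]; ring
  rw [e]; positivity

end ThreeApex

end FK

end Summit.CriticalPhenomena.PercolationContinuityZ3.Theorems
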